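import Literature.AlgebraicGeometry.Pohlmann1968.HodgeClassesProductSpanCMProductsDisjoint
import Literature.AlgebraicGeometry.Pohlmann1968.SimpleCMAbelianVarietyPowersDivisorGenerated
import Literature.AlgebraicGeometry.Pohlmann1968.NondegenerateCMTypeDivisorGenerated
import Literature.AlgebraicGeometry.ComplexMultiplication.ShimuraIsogenyHolds
import Literature.NumberTheory.ComplexMultiplication.CMFieldConjSquareQuadraticSubfields
import Summits.HodgeConjecture.CorCM.CyclicSexticHodgeRungOfMarkman
import Summits.HodgeConjecture.CorCM.Model.CMProdBiproduct
import Summits.HodgeConjecture.CorCM.ShimuraIsogenousPowerHolds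
import HarnessLib

/-!
# COR-CM (cell `pub-hodgecm2`): the Hodge conjecture is MULTIPLICATIVE across CM products with linearly disjoint
# Galois closures — and the cyclic sextic tower `B^{a+1} × E^{b+1} × E′^{c+1}` given Markman's theorem only

HONEST FRAMING (seat b25 gen 33; COUNT-NEUTRAL — no binder row of `HOME/BINDER-OWNERS.md`; consumer of this seat's
Literature theorem `Pohlmann1968.hodgeClassesProductSpan_biproduct_of_blockwiseIndependent`
(`Literature/AlgebraicGeometry/Pohlmann1968/HodgeClassesProductSpanCMProducts{,Setup,Blocks,Disjoint}`): Hodge classes on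
`X × Y` are exterior products of Hodge classes of the factors when `X`, `Y` are CM products on whose coefficient
fields `Aut(ℂ)` acts blockwise independently).  §§1–3 are UNCONDITIONAL junctions in the cell's domination
vocabulary (`Domination.AVDominatedBy`, `Domination.cmProdAV`, `AbelianVariety.IsProductOf`); §4 is CONDITIONAL on
the displayed named fact `HodgeTheory.Markman2025_weilClasses_algebraic_abelianFourfold` exactly as seat b30's rung
`CorCM/CyclicSexticHodgeRungOfMarkman` is, and on nothing else.

WHAT IS NEW.  The tree's linear-disjointness criterion (`CorCM/LinearlyDisjointCMFieldsHodge`,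
`hodgeConjectureFor_prod_of_normalClosure_inf_eq_bot`; Gordon 1999 §3 after Imai, Murty) needs every CM type
NONDEGENERATE (then `B• = D•`).  Here no type needs to be nondegenerate: for CM products `X`, `Y` whose composita of
Galois closures meet in `ℚ`, `HC(X) ∧ HC(Y) ⟹ HC(B)` for every `B` dominated by `X × Y`, whatever the source of
`HC(X)` — e.g. Markman's theorem on the Weil classes of the DEGENERATE pairs inside `X`.

* §1 `hodgeConjectureFor_of_avDominatedBy_prod_of_normalClosure_inf_eq_bot` (dependent families `K_i`, `K'_j`),
  `…_prod_slots_…` (labelled families `K₁ ∘ π₁`, `K₂ ∘ π₂`, the shape of `CorCM/IndependentCMFieldsHodge`);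
* §2 `hodgeConjectureFor_of_avDominatedBy_cmProdAV_prod_cmProdAV` — two CM fields `F₁`, `F₂` with
  `F₁^{gal} ∩ F₂^{gal} = ℚ`: `HC(∏_j A_{(F₁,Θ¹_j)}) ∧ HC(∏_j A_{(F₂,Θ²_j)}) ⟹ HC(B)` for all
  `B ≼ ∏_j A_{(F₁,Θ¹_j)} × ∏_j A_{(F₂,Θ²_j)}` (`nonempty_cmProdAV_iso_biproduct`, `isCMTypeRealisation_cmCode`);
  `…_isProductOf_prod_isProductOf` — the same for finite products `P₁`, `P₂` of realisations of CM types of CM fields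
  EMBEDDABLE in `F₁`, resp. `F₂` (Shimura inflation, `exists_avDominatedBy_cmProdAV_of_isProductOf_realisations`, its
  binders discharged by `shimura1998_Thm3_isogenousPower_holds`, `Shimura1998_Thm2_Cor_holds`);
  `…_isProductOf_prod_powSucc_of_isNondegenerate` — second factor a power `A′^{c+1}` of a realisation of a
  NONDEGENERATE type of any CM field `k′` with `F₁^{gal} ∩ k′^{gal} = ℚ` (its HC is the tree's unconditional
  `IsNondegenerate.hodgeConjectureFor_powSucc`);
* §3 `normalClosure_inf_normalClosure_eq_bot_of_isEmpty` — field lemma: `K` Galois, `k′` quadratic with no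
  embedding `k′ → K` ⟹ `K^{gal} ∩ k′^{gal} = ℚ`;
* §4 (namespace `CyclicSextic`) **the E′-clause of PORTFOLIO-lit-andre-3-g7 §9.3**: for a Galois SEXTIC CM field `K`,
  `hodgeConjectureFor_cmProdAV_sextic_of_markman_closed` (`HC(∏_j A_{(K,Θ_j)})`, b30's rung with every model record
  discharged), `hodgeConjectureFor_of_avDominatedBy_isProductOf_prod_isProductOf_sextic_of_markman`,
  `…_isProductOf_prod_powSucc_sextic_of_markman`, and the headline
  **`hodgeConjectureFor_of_avDominatedBy_powSucc_prod_powSucc_prod_powSucc_sextic_of_markman`**: `B` realising a CM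
  type of `K`, `E` one of a CM field `E₀ ↪ K` (the imaginary quadratic subfield: the DEGENERATE pair carrying the Weil
  classes Markman's theorem makes algebraic), `E′` a realisation of a nondegenerate type of a CM field `k′` with
  `K ∩ k′^{gal} = ℚ` — HC for every abelian variety dominated by `B^{a+1} × E^{b+1} × E′^{c+1}`, GIVEN ONLY Markman's
  fourfold theorem; `…_of_finrank_eq_two` — `E′` a CM elliptic curve (`[k′:ℚ] = 2`, every type nondegenerate) whose
  field does not embed in `K`.  (Lit-andre-3's census `Census/CyclicSexticSpecies.lean` is the combinatorial shadow:
  "with a second CM curve `E′` (`k′ ∩ F = ℚ`): H rank 6, index 1 again".)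

THEOREMS ONLY; no definition, no named fact introduced, no `sorry`; axioms `propext`, `Classical.choice`, `Quot.sound`.

## References
* [MoonenZarhin1999LowDim] B. Moonen, Yu. Zarhin, Math. Ann. 315 (1999), §3 (3.1) (`Hg(X₁ × X₂) = Hg(X₁) × Hg(X₂)`).
* [Gordon1999HodgeAVSurvey] B. B. Gordon, *A survey of the Hodge conjecture for abelian varieties*, §3 Theorem (Imai,
  Murty) with proof.
* [Markman2025SurveySecant] E. Markman, arXiv:2509.23403, Thm. 1.2 (the displayed hypothesis of §4).
* [Andre1992HodgeCM] Y. André, Progr. Math. 102 (1992), Théorème (pp. 4–5).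
* [Shimura1998] G. Shimura, *Abelian Varieties with Complex Multiplication and Modular Functions*, §6.1–6.2.
* [Lang2002] S. Lang, *Algebra*, VI §1 Thm. 1.14, V §3 Thm. 3.3.
-/

noncomputable section

open CategoryTheory CategoryTheory.Limits NumberField IntermediateField

namespace Summit.HodgeConjecture.CorCM

open Literature.AlgebraicGeometry.Motives (AbelianVariety CMType)
open Literature.AlgebraicGeometry.Motives.AbelianVariety
open Literature.AlgebraicGeometry.HodgeTheory
open Literature.AlgebraicGeometry.ComplexMultiplication (IsCMTypeRealisation Shimura1998_Thm2_Cor_holds)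
open Literature.AlgebraicGeometry.Pohlmann1968
open Literature.NumberTheory.ComplexMultiplication (normalClosure_eq_fieldRange_of_normal apply_mem_normalClosure)
open Literature.NumberTheory.Automorphic.PicardCM (cmRealisation CMAbelianVarietyRealised
  ballQuotientUniformisedDatum_of)
open Summit.HodgeConjecture.CorCM.Domination

/-! ## §1 Dependent and labelled families -/

section Families

variable {n m : ℕ} {K : Fin n → Type} {K' : Fin m → Type}
  [∀ i, Field (K i)] [∀ i, NumberField (K i)] [∀ j, Field (K' j)] [∀ j, NumberField (K' j)]
  {Φ : ∀ i, CMType (K i)} {Φ' : ∀ j, CMType (K' j)}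
  {A : Fin n → AbelianVariety ℂ} {A' : Fin m → AbelianVariety ℂ}
  {ι : ∀ i, 𝓞 (K i) →+* End (A i)} {ι' : ∀ j, 𝓞 (K' j) →+* End (A' j)}
  {θ : ∀ i, K i →+* Module.End ℂ (complexBetti (A i).X 1)}
  {θ' : ∀ j, K' j →+* Module.End ℂ (complexBetti (A' j).X 1)}

/-- **HC is multiplicative across CM products with linearly disjoint Galois closures (domination form).**  For
realisations `(A_i, ι_i, θ_i)` of CM types of number fields `K_i` and `(A'_j, ι'_j, θ'_j)` of `K'_j` with
`(∏_i K_i^{gal}) ∩ (∏_j K'_j^{gal}) = ℚ` in `ℂ`, `X ∼ ⨁ A_i`, `Y ∼ ⨁ A'_j`: `HC(X) ∧ HC(Y) ⟹ HC(B)` for every `B`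
dominated by `X × Y` (`s ≫ π = [N]_B`).  No nondegeneracy is assumed.
[cite: MoonenZarhin1999LowDim, §3 (3.1)] [cite: Gordon1999HodgeAVSurvey, §3 Theorem (Imai, Murty) with proof] -/
theorem hodgeConjectureFor_of_avDominatedBy_prod_of_normalClosure_inf_eq_bot
    (hA : ∀ i, IsCMTypeRealisation (Φ i) (A i) (ι i) (θ i))
    (hA' : ∀ j, IsCMTypeRealisation (Φ' j) (A' j) (ι' j) (θ' j))
    (H : (⨆ i, normalClosure ℚ (K i) ℂ) ⊓ (⨆ j, normalClosure ℚ (K' j) ℂ) = ⊥)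
    {X Y B : AbelianVariety ℂ} (hX : IsIsogenous X (⨁ A)) (hY : IsIsogenous Y (⨁ A'))
    (hHX : HodgeConjectureFor X.dim X.X) (hHY : HodgeConjectureFor Y.dim Y.X)
    (hB : AVDominatedBy B (X.prod Y)) : HodgeConjectureFor B.dim B.X :=
  hodgeConjectureFor_of_avDominatedBy
    (hodgeConjectureFor_prod_of_isIsogenous_biproduct_of_normalClosure_inf_eq_bot hA hA' H hX hY hHX hHY) hB

end Families

section Labelled

variable {I₁ I₂ : Type} {K₁ : I₁ → Type} {K₂ : I₂ → Type}
  [∀ i, Field (K₁ i)] [∀ i, NumberField (K₁ i)] [∀ i, Field (K₂ i)] [∀ i, NumberField (K₂ i)]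
  {Φ₁ : ∀ i, CMType (K₁ i)} {Φ₂ : ∀ i, CMType (K₂ i)}
  {A₁ : I₁ → AbelianVariety ℂ} {A₂ : I₂ → AbelianVariety ℂ}
  {ι₁ : ∀ i, 𝓞 (K₁ i) →+* End (A₁ i)} {ι₂ : ∀ i, 𝓞 (K₂ i) →+* End (A₂ i)}
  {θ₁ : ∀ i, K₁ i →+* Module.End ℂ (complexBetti (A₁ i).X 1)}
  {θ₂ : ∀ i, K₂ i →+* Module.End ℂ (complexBetti (A₂ i).X 1)}

/-- **Labelled form** (the shape of `CorCM/IndependentCMFieldsHodge`): two labelled families of realisations over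
fields `K₁ i` (`i ∈ I₁`), `K₂ i` (`i ∈ I₂`) with `(∏ K₁ i^{gal}) ∩ (∏ K₂ i^{gal}) = ℚ`, slot maps `π₁`, `π₂`;
`HC(⨁_j A₁ (π₁ j)) ∧ HC(⨁_j A₂ (π₂ j)) ⟹ HC(B)` for every `B` dominated by the product of the two slot products.
[cite: MoonenZarhin1999LowDim, §3 (3.1)] [cite: Gordon1999HodgeAVSurvey, §3 Theorem (Imai, Murty) with proof] -/
theorem hodgeConjectureFor_of_avDominatedBy_prod_slots_of_normalClosure_inf_eq_bot
    (hA₁ : ∀ i, IsCMTypeRealisation (Φ₁ i) (A₁ i) (ι₁ i) (θ₁ i))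
    (hA₂ : ∀ i, IsCMTypeRealisation (Φ₂ i) (A₂ i) (ι₂ i) (θ₂ i))
    (H : (⨆ i, normalClosure ℚ (K₁ i) ℂ) ⊓ (⨆ i, normalClosure ℚ (K₂ i) ℂ) = ⊥)
    {N₁ N₂ : ℕ} (π₁ : Fin N₁ → I₁) (π₂ : Fin N₂ → I₂)
    (hH₁ : HodgeConjectureFor (⨁ fun j => A₁ (π₁ j)).dim (⨁ fun j => A₁ (π₁ j)).X)
    (hH₂ : HodgeConjectureFor (⨁ fun j => A₂ (π₂ j)).dim (⨁ fun j => A₂ (π₂ j)).X)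
    {B : AbelianVariety ℂ} (hB : AVDominatedBy B ((⨁ fun j => A₁ (π₁ j)).prod (⨁ fun j => A₂ (π₂ j)))) :
    HodgeConjectureFor B.dim B.X := by
  have H' : (⨆ j, normalClosure ℚ (K₁ (π₁ j)) ℂ) ⊓ (⨆ j, normalClosure ℚ (K₂ (π₂ j)) ℂ) = ⊥ :=
    eq_bot_iff.2 (le_trans (inf_le_inf
      (iSup_le fun j => le_iSup (fun i => normalClosure ℚ (K₁ i) ℂ) (π₁ j))
      (iSup_le fun j => le_iSup (fun i => normalClosure ℚ (K₂ i) ℂ) (π₂ j))) H.le)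
  exact hodgeConjectureFor_of_avDominatedBy_prod_of_normalClosure_inf_eq_bot
    (K := fun j => K₁ (π₁ j)) (K' := fun j => K₂ (π₂ j)) (fun j => hA₁ (π₁ j)) (fun j => hA₂ (π₂ j)) H'
    (IsIsogenous.refl _) (IsIsogenous.refl _) hH₁ hH₂ hB

end Labelled

/-! ## §2 Two CM fields with `F₁^{gal} ∩ F₂^{gal} = ℚ`: the cell's products `∏_j A_{(F,Θ_j)}` and product trees -/

section TwoFields

variable {F₁ F₂ : Type} [Field F₁] [NumberField F₁] [IsCMField F₁] [Field F₂] [NumberField F₂] [IsCMField F₂]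

/-- **`HC(∏_j A_{(F₁,Θ¹_j)}) ∧ HC(∏_j A_{(F₂,Θ²_j)}) ⟹ HC(B)` for every `B ≼ ∏_j A_{(F₁,Θ¹_j)} × ∏_j A_{(F₂,Θ²_j)}`**,
for CM fields with `F₁^{gal} ∩ F₂^{gal} = ℚ` (`cmProdAV F h₃ n Θ ≅ ⨁_j A_{(F,Θ_j)}`, each chosen realisation read
over `F` by `isCMTypeRealisation_cmCode`; constant coefficient families).
[cite: MoonenZarhin1999LowDim, §3 (3.1)] [cite: Gordon1999HodgeAVSurvey, §3 Theorem (Imai, Murty) with proof] -/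
theorem hodgeConjectureFor_of_avDominatedBy_cmProdAV_prod_cmProdAV (h₃ : CMAbelianVarietyRealised)
    (H : normalClosure ℚ F₁ ℂ ⊓ normalClosure ℚ F₂ ℂ = ⊥)
    {n₁ n₂ : ℕ} {Θ₁ : Fin (n₁ + 1) → CMType F₁} {Θ₂ : Fin (n₂ + 1) → CMType F₂}
    (h₁ : HodgeConjectureFor (cmProdAV F₁ h₃ n₁ Θ₁).dim (cmProdAV F₁ h₃ n₁ Θ₁).X)
    (h₂ : HodgeConjectureFor (cmProdAV F₂ h₃ n₂ Θ₂).dim (cmProdAV F₂ h₃ n₂ Θ₂).X)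
    {B : AbelianVariety ℂ} (hB : AVDominatedBy B ((cmProdAV F₁ h₃ n₁ Θ₁).prod (cmProdAV F₂ h₃ n₂ Θ₂))) :
    HodgeConjectureFor B.dim B.X := by
  obtain ⟨e₁⟩ := nonempty_cmProdAV_iso_biproduct F₁ h₃ n₁ Θ₁
  obtain ⟨e₂⟩ := nonempty_cmProdAV_iso_biproduct F₂ h₃ n₂ Θ₂
  have H' : (⨆ _ : Fin (n₁ + 1), normalClosure ℚ F₁ ℂ) ⊓ (⨆ _ : Fin (n₂ + 1), normalClosure ℚ F₂ ℂ) = ⊥ := by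
    rwa [iSup_const, iSup_const]
  exact hodgeConjectureFor_of_avDominatedBy_prod_of_normalClosure_inf_eq_bot
    (K := fun _ : Fin (n₁ + 1) => F₁) (K' := fun _ : Fin (n₂ + 1) => F₂)
    (fun j => isCMTypeRealisation_cmCode F₁ h₃ (Θ₁ j)) (fun j => isCMTypeRealisation_cmCode F₂ h₃ (Θ₂ j)) H'
    ⟨e₁.hom, isIsogeny_hom_of_iso e₁⟩ ⟨e₂.hom, isIsogeny_hom_of_iso e₂⟩ h₁ h₂ hB

/-- **Product trees over two fields.**  `P₁`, `P₂` finite products (`AbelianVariety.IsProductOf`) of realisations of CM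
types of CM fields embeddable in `F₁`, resp. `F₂`, `F₁^{gal} ∩ F₂^{gal} = ℚ`; if HC holds for every product
`∏_j A_{(F₁,Θ_j)}` and every `∏_j A_{(F₂,Θ_j)}`, then HC holds for every `B ≼ P₁ × P₂` (Shimura inflation dominates
each `P_r` by such a product; its binders are theorems of the tree).
[cite: Shimura1998, §6.2 Theorem 3 and §6.1 Corollary of Theorem 2 (pp. 41–43)] [cite: MoonenZarhin1999LowDim, §3 (3.1)] -/
theorem hodgeConjectureFor_of_avDominatedBy_isProductOf_prod_isProductOf (h₃ : CMAbelianVarietyRealised)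
    (H : normalClosure ℚ F₁ ℂ ⊓ normalClosure ℚ F₂ ℂ = ⊥)
    (hHC₁ : ∀ (n : ℕ) (Θ : Fin (n + 1) → CMType F₁),
      HodgeConjectureFor (cmProdAV F₁ h₃ n Θ).dim (cmProdAV F₁ h₃ n Θ).X)
    (hHC₂ : ∀ (n : ℕ) (Θ : Fin (n + 1) → CMType F₂),
      HodgeConjectureFor (cmProdAV F₂ h₃ n Θ).dim (cmProdAV F₂ h₃ n Θ).X)
    {P₁ P₂ B : AbelianVariety ℂ}
    (hP₁ : AbelianVariety.IsProductOf (fun B : AbelianVariety ℂ =>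
      ∃ (E : Type) (_ : Field E) (_ : NumberField E) (_ : IsCMField E) (_ : E →+* F₁) (Φ : CMType E)
        (ι : 𝓞 E →+* End B) (θ : E →+* Module.End ℂ (complexBetti B.X 1)), IsCMTypeRealisation Φ B ι θ) P₁)
    (hP₂ : AbelianVariety.IsProductOf (fun B : AbelianVariety ℂ =>
      ∃ (E : Type) (_ : Field E) (_ : NumberField E) (_ : IsCMField E) (_ : E →+* F₂) (Φ : CMType E)
        (ι : 𝓞 E →+* End B) (θ : E →+* Module.End ℂ (complexBetti B.X 1)), IsCMTypeRealisation Φ B ι θ) P₂)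
    (hB : AVDominatedBy B (P₁.prod P₂)) : HodgeConjectureFor B.dim B.X := by
  obtain ⟨n₁, Θ₁, hd₁⟩ := exists_avDominatedBy_cmProdAV_of_isProductOf_realisations h₃
    shimura1998_Thm3_isogenousPower_holds Shimura1998_Thm2_Cor_holds hP₁
  obtain ⟨n₂, Θ₂, hd₂⟩ := exists_avDominatedBy_cmProdAV_of_isProductOf_realisations h₃
    shimura1998_Thm3_isogenousPower_holds Shimura1998_Thm2_Cor_holds hP₂
  exact hodgeConjectureFor_of_avDominatedBy_cmProdAV_prod_cmProdAV h₃ H (hHC₁ n₁ Θ₁) (hHC₂ n₂ Θ₂)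
    (hB.trans (hd₁.prod hd₂))

/-- **Second factor a power of a realisation of a NONDEGENERATE type** (its HC is unconditional, the tree's
`IsNondegenerate.hodgeConjectureFor_powSucc`): `P₁` a product tree of realisations of types of CM fields embeddable
in `F₁`, `A′` a realisation of a nondegenerate CM type of a number field `k′` with `F₁^{gal} ∩ k′^{gal} = ℚ`; if HC
holds for every `∏_j A_{(F₁,Θ_j)}`, then HC holds for every `B ≼ P₁ × A′^{c+1}`.
[cite: Gordon1999HodgeAVSurvey, Thm. 6.4 and §9.3] [cite: MoonenZarhin1999LowDim, §3 (3.1)] -/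
theorem hodgeConjectureFor_of_avDominatedBy_isProductOf_prod_powSucc_of_isNondegenerate
    (h₃ : CMAbelianVarietyRealised)
    (hHC₁ : ∀ (n : ℕ) (Θ : Fin (n + 1) → CMType F₁),
      HodgeConjectureFor (cmProdAV F₁ h₃ n Θ).dim (cmProdAV F₁ h₃ n Θ).X)
    {k' : Type} [Field k'] [NumberField k'] [IsCMField k'] {Φ' : CMType k'} {A' : AbelianVariety ℂ}
    {ι' : 𝓞 k' →+* End A'} {θ' : k' →+* Module.End ℂ (complexBetti A'.X 1)}
    (hA' : IsCMTypeRealisation Φ' A' ι' θ') (hΦ' : IsNondegenerate Φ')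
    (H : normalClosure ℚ F₁ ℂ ⊓ normalClosure ℚ k' ℂ = ⊥) {P₁ B : AbelianVariety ℂ}
    (hP₁ : AbelianVariety.IsProductOf (fun B : AbelianVariety ℂ =>
      ∃ (E : Type) (_ : Field E) (_ : NumberField E) (_ : IsCMField E) (_ : E →+* F₁) (Φ : CMType E)
        (ι : 𝓞 E →+* End B) (θ : E →+* Module.End ℂ (complexBetti B.X 1)), IsCMTypeRealisation Φ B ι θ) P₁)
    (c : ℕ) (hB : AVDominatedBy B (P₁.prod (A'.powSucc c))) : HodgeConjectureFor B.dim B.X := by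
  obtain ⟨n₁, Θ₁, hd₁⟩ := exists_avDominatedBy_cmProdAV_of_isProductOf_realisations h₃
    shimura1998_Thm3_isogenousPower_holds Shimura1998_Thm2_Cor_holds hP₁
  obtain ⟨e₁⟩ := nonempty_cmProdAV_iso_biproduct F₁ h₃ n₁ Θ₁
  have H' : (⨆ _ : Fin (n₁ + 1), normalClosure ℚ F₁ ℂ) ⊓ (⨆ _ : Fin (c + 1), normalClosure ℚ k' ℂ) = ⊥ := by
    rwa [iSup_const, iSup_const]
  exact hodgeConjectureFor_of_avDominatedBy_prod_of_normalClosure_inf_eq_bot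
    (K := fun _ : Fin (n₁ + 1) => F₁) (K' := fun _ : Fin (c + 1) => k')
    (fun j => isCMTypeRealisation_cmCode F₁ h₃ (Θ₁ j)) (fun _ => hA') H'
    ⟨e₁.hom, isIsogeny_hom_of_iso e₁⟩ (isIsogenous_powSucc_biproduct A' c) (hHC₁ n₁ Θ₁)
    (hΦ'.hodgeConjectureFor_powSucc hA' c) (hB.trans (hd₁.prod (AVDominatedBy.refl _)))

end TwoFields

/-! ## §3 Field lemma: a quadratic field not embeddable in a Galois field meets it trivially in `ℂ` -/

section FieldLemma

/-- **`K^{gal} ∩ k′^{gal} = ℚ` for `K` Galois and `k′` quadratic with no embedding `k′ → K`.**  The Galois closure of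
the normal field `K` (resp. `k′`) in `ℂ` is the image of any one embedding; a non-trivial subfield of the quadratic
`t(k′)` is all of it, so `t(k′) ≤ s(K)` would give an embedding `k′ ≅ t(k′) ↪ s(K) ≅ K`.
[cite: Lang2002, V §3 Thm. 3.3 and VI §1 Cor. 1.4] -/
theorem normalClosure_inf_normalClosure_eq_bot_of_isEmpty {K k' : Type} [Field K] [NumberField K] [IsGalois ℚ K]
    [Field k'] [NumberField k'] (hk : Module.finrank ℚ k' = 2) (hK : IsEmpty (k' →+* K)) :
    normalClosure ℚ K ℂ ⊓ normalClosure ℚ k' ℂ = ⊥ := by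
  obtain ⟨s⟩ : Nonempty (K →ₐ[ℚ] ℂ) :=
    ⟨(Classical.choice (inferInstance : Nonempty (K →+* ℂ))).toRatAlgHom⟩
  obtain ⟨t⟩ : Nonempty (k' →ₐ[ℚ] ℂ) :=
    ⟨(Classical.choice (inferInstance : Nonempty (k' →+* ℂ))).toRatAlgHom⟩
  haveI : Algebra.IsQuadraticExtension ℚ k' := { finrank_eq_two' := hk }
  rw [normalClosure_eq_fieldRange_of_normal s, normalClosure_eq_fieldRange_of_normal t]
  by_contra hne
  have hk2 : Module.finrank ℚ t.fieldRange = 2 := by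
    rw [← hk]; exact (AlgEquiv.ofInjectiveField t).toLinearEquiv.finrank_eq.symm
  haveI : FiniteDimensional ℚ t.fieldRange := Module.finite_of_finrank_pos (by rw [hk2]; norm_num)
  -- `s(K) ⊓ t(k′)` is a non-trivial subfield of the quadratic `t(k′)`, hence all of it
  have hdvd : Module.finrank ℚ ↥(s.fieldRange ⊓ t.fieldRange) ∣ 2 :=
    hk2 ▸ IntermediateField.finrank_dvd_of_le_right (inf_le_right : s.fieldRange ⊓ t.fieldRange ≤ t.fieldRange)
  have h1 : Module.finrank ℚ ↥(s.fieldRange ⊓ t.fieldRange) ≠ 1 := fun h =>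
    hne (IntermediateField.finrank_eq_one_iff.1 h)
  have h2 : Module.finrank ℚ ↥(s.fieldRange ⊓ t.fieldRange) = 2 := by
    rcases (Nat.dvd_prime Nat.prime_two).1 hdvd with h | h
    · exact absurd h h1
    · exact h
  have hle : t.fieldRange ≤ s.fieldRange :=
    inf_eq_right.1 (IntermediateField.eq_of_le_of_finrank_eq inf_le_right (by rw [h2, hk2]))
  -- the embedding `k′ → t(k′) ↪ s(K) ≅ K` (on the underlying subalgebras)
  have hle' : t.range ≤ s.range := fun x hx => (hle (show x ∈ t.fieldRange from hx) : x ∈ s.fieldRange)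
  exact hK.false (((AlgEquiv.ofInjectiveField s).symm.toAlgHom.comp
    ((Subalgebra.inclusion hle').comp t.rangeRestrict)).toRingHom)

end FieldLemma

/-! ## §4 The cyclic (Galois) sextic tower with an independent factor, given Markman's theorem only -/

namespace CyclicSextic

/-- **`HC(∏_j A_{(K,Θ_j)})` for a Galois sextic CM field `K`, every model record discharged** — seat b30's
`hodgeConjectureFor_of_avDominatedBy_cmProdAV_sextic_of_markman'` at the identity domination, with the Picard-surface
uniformisation datum supplied by `BallQuotient.ballQuotientUniformised_holds`; displayed leaf: Markman's theorem.
[cite: Markman2025SurveySecant, Thm. 1.2] [cite: Andre1992HodgeCM, Théorème (pp. 4–5)] -/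
theorem hodgeConjectureFor_cmProdAV_sextic_of_markman_closed
    (hW4 : Markman2025_weilClasses_algebraic_abelianFourfold) (K : CMField) [IsGalois ℚ K]
    (h6 : Module.finrank ℚ K = 6) {n : ℕ} (Θ : Fin (n + 1) → CMType K) :
    HodgeConjectureFor (cmProdAV K cmAbelianVarietyRealised_holds n Θ).dim
      (cmProdAV K cmAbelianVarietyRealised_holds n Θ).X :=
  hodgeConjectureFor_of_avDominatedBy_cmProdAV_sextic_of_markman'
    (ballQuotientUniformisedDatum_of BallQuotient.ballQuotientUniformised_holds) hW4 K h6 _ (AVDominatedBy.refl _)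

/-- **The sextic slice times an independent slice.**  `K` a Galois sextic CM field, `F₂` a CM field with
`K ∩ F₂^{gal} = ℚ` on which HC is known for every `∏_j A_{(F₂,Θ_j)}`; `P₁`, `P₂` product trees of realisations of CM
types of CM fields embeddable in `K`, resp. `F₂`.  Then HC holds for every `B ≼ P₁ × P₂`, given Markman's fourfold
theorem. [cite: Markman2025SurveySecant, Thm. 1.2] [cite: MoonenZarhin1999LowDim, §3 (3.1)] -/
theorem hodgeConjectureFor_of_avDominatedBy_isProductOf_prod_isProductOf_sextic_of_markman
    (hW4 : Markman2025_weilClasses_algebraic_abelianFourfold) (K : CMField) [IsGalois ℚ K]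
    (h6 : Module.finrank ℚ K = 6) {F₂ : Type} [Field F₂] [NumberField F₂] [IsCMField F₂]
    (H : normalClosure ℚ K ℂ ⊓ normalClosure ℚ F₂ ℂ = ⊥)
    (hHC₂ : ∀ (n : ℕ) (Θ : Fin (n + 1) → CMType F₂),
      HodgeConjectureFor (cmProdAV F₂ cmAbelianVarietyRealised_holds n Θ).dim
        (cmProdAV F₂ cmAbelianVarietyRealised_holds n Θ).X)
    {P₁ P₂ B : AbelianVariety ℂ}
    (hP₁ : AbelianVariety.IsProductOf (fun B : AbelianVariety ℂ =>
      ∃ (E : Type) (_ : Field E) (_ : NumberField E) (_ : IsCMField E) (_ : E →+* (K : Type)) (Φ : CMType E)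
        (ι : 𝓞 E →+* End B) (θ : E →+* Module.End ℂ (complexBetti B.X 1)), IsCMTypeRealisation Φ B ι θ) P₁)
    (hP₂ : AbelianVariety.IsProductOf (fun B : AbelianVariety ℂ =>
      ∃ (E : Type) (_ : Field E) (_ : NumberField E) (_ : IsCMField E) (_ : E →+* F₂) (Φ : CMType E)
        (ι : 𝓞 E →+* End B) (θ : E →+* Module.End ℂ (complexBetti B.X 1)), IsCMTypeRealisation Φ B ι θ) P₂)
    (hB : AVDominatedBy B (P₁.prod P₂)) : HodgeConjectureFor B.dim B.X :=
  hodgeConjectureFor_of_avDominatedBy_isProductOf_prod_isProductOf cmAbelianVarietyRealised_holds H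
    (fun _ Θ => hodgeConjectureFor_cmProdAV_sextic_of_markman_closed hW4 K h6 Θ) hHC₂ hP₁ hP₂ hB

/-- **The sextic slice times powers of a realisation of a nondegenerate type.**  `K` a Galois sextic CM field, `P₁`
a product tree of realisations of CM types of CM fields embeddable in `K`, `A′` a realisation of a NONDEGENERATE CM
type of a number field `k′` with `K ∩ k′^{gal} = ℚ`: HC for every `B ≼ P₁ × A′^{c+1}`, given Markman's fourfold
theorem. [cite: Markman2025SurveySecant, Thm. 1.2] [cite: Gordon1999HodgeAVSurvey, Thm. 6.4 and §9.3] -/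
theorem hodgeConjectureFor_of_avDominatedBy_isProductOf_prod_powSucc_sextic_of_markman
    (hW4 : Markman2025_weilClasses_algebraic_abelianFourfold) (K : CMField) [IsGalois ℚ K]
    (h6 : Module.finrank ℚ K = 6) {k' : Type} [Field k'] [NumberField k'] [IsCMField k'] {Φ' : CMType k'}
    {A' : AbelianVariety ℂ} {ι' : 𝓞 k' →+* End A'} {θ' : k' →+* Module.End ℂ (complexBetti A'.X 1)}
    (hA' : IsCMTypeRealisation Φ' A' ι' θ') (hΦ' : IsNondegenerate Φ')
    (H : normalClosure ℚ K ℂ ⊓ normalClosure ℚ k' ℂ = ⊥) {P₁ B : AbelianVariety ℂ}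
    (hP₁ : AbelianVariety.IsProductOf (fun B : AbelianVariety ℂ =>
      ∃ (E : Type) (_ : Field E) (_ : NumberField E) (_ : IsCMField E) (_ : E →+* (K : Type)) (Φ : CMType E)
        (ι : 𝓞 E →+* End B) (θ : E →+* Module.End ℂ (complexBetti B.X 1)), IsCMTypeRealisation Φ B ι θ) P₁)
    (c : ℕ) (hB : AVDominatedBy B (P₁.prod (A'.powSucc c))) : HodgeConjectureFor B.dim B.X :=
  hodgeConjectureFor_of_avDominatedBy_isProductOf_prod_powSucc_of_isNondegenerate cmAbelianVarietyRealised_holds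
    (fun _ Θ => hodgeConjectureFor_cmProdAV_sextic_of_markman_closed hW4 K h6 Θ) hA' hΦ' H hP₁ c hB

/-- **Headline `B^{a+1} × E^{b+1} × E′^{c+1}` (the E′-clause of the cyclic sextic tower).**  `K` a Galois sextic CM
field, `(B, ι_B, θ_B)` a realisation of a CM type of `K`, `(E, ι_E, θ_E)` a realisation of a CM type of a CM field
`E₀ ↪ K` (the imaginary quadratic subfield: `B × E` is the DEGENERATE pair whose Weil classes Markman's theorem
makes algebraic), `(E′, ι′, θ′)` a realisation of a NONDEGENERATE CM type of a number field `k′` with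
`K ∩ k′^{gal} = ℚ`.  Then the Hodge conjecture holds for every complex abelian variety dominated by
`B^{a+1} × E^{b+1} × E′^{c+1}`, GIVEN ONLY Markman's fourfold theorem.
[cite: Markman2025SurveySecant, Thm. 1.2] [cite: Andre1992HodgeCM, Théorème (pp. 4–5)] [cite: MoonenZarhin1999LowDim, §3 (3.1)] -/
theorem hodgeConjectureFor_of_avDominatedBy_powSucc_prod_powSucc_prod_powSucc_sextic_of_markman
    (hW4 : Markman2025_weilClasses_algebraic_abelianFourfold) (K : CMField) [IsGalois ℚ K]
    (h6 : Module.finrank ℚ K = 6)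
    {Ψ : CMType K} {B : AbelianVariety ℂ} {ιB : 𝓞 K →+* End B}
    {θB : (K : Type) →+* Module.End ℂ (complexBetti B.X 1)} (hB : IsCMTypeRealisation Ψ B ιB θB)
    {E₀ : Type} [Field E₀] [NumberField E₀] [IsCMField E₀] (k : E₀ →+* (K : Type)) {Φ₀ : CMType E₀}
    {E : AbelianVariety ℂ} {ιE : 𝓞 E₀ →+* End E} {θE : E₀ →+* Module.End ℂ (complexBetti E.X 1)}
    (hE : IsCMTypeRealisation Φ₀ E ιE θE)
    {k' : Type} [Field k'] [NumberField k'] [IsCMField k'] {Φ' : CMType k'} {E' : AbelianVariety ℂ} {ιE' : 𝓞 k' →+* End E'}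
    {θE' : k' →+* Module.End ℂ (complexBetti E'.X 1)} (hE' : IsCMTypeRealisation Φ' E' ιE' θE')
    (hΦ' : IsNondegenerate Φ') (H : normalClosure ℚ K ℂ ⊓ normalClosure ℚ k' ℂ = ⊥) (a b c : ℕ)
    {A : AbelianVariety ℂ} (hA : AVDominatedBy A (((B.powSucc a).prod (E.powSucc b)).prod (E'.powSucc c))) :
    HodgeConjectureFor A.dim A.X :=
  hodgeConjectureFor_of_avDominatedBy_isProductOf_prod_powSucc_sextic_of_markman hW4 K h6 hE' hΦ' H
    (isProductOf_powSucc_prod_powSucc (Q := fun B : AbelianVariety ℂ =>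
      ∃ (E : Type) (_ : Field E) (_ : NumberField E) (_ : IsCMField E) (_ : E →+* (K : Type)) (Φ : CMType E)
        (ι : 𝓞 E →+* End B) (θ : E →+* Module.End ℂ (complexBetti B.X 1)), IsCMTypeRealisation Φ B ι θ)
      ⟨K, inferInstance, inferInstance, inferInstance, RingHom.id _, Ψ, ιB, θB, hB⟩
      ⟨E₀, inferInstance, inferInstance, inferInstance, k, Φ₀, ιE, θE, hE⟩ a b) c hA

/-- **… with `E′` a CM elliptic curve whose field does not embed in `K`**: `[k′:ℚ] = 2` (every CM type of `k′` is
nondegenerate, `E′` is an elliptic curve with CM by `k′`) and no embedding `k′ → K` (for the cyclic sextic `K`: `k′`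
is not its imaginary quadratic subfield).  HC for every abelian variety dominated by `B^{a+1} × E^{b+1} × E′^{c+1}`,
given Markman's fourfold theorem only. [cite: Markman2025SurveySecant, Thm. 1.2] [cite: MoonenZarhin1999LowDim, §3 (3.1) and Cor. (3.9)] -/
theorem hodgeConjectureFor_of_avDominatedBy_powSucc_prod_powSucc_prod_powSucc_sextic_of_markman_of_finrank_eq_two
    (hW4 : Markman2025_weilClasses_algebraic_abelianFourfold) (K : CMField) [IsGalois ℚ K]
    (h6 : Module.finrank ℚ K = 6)
    {Ψ : CMType K} {B : AbelianVariety ℂ} {ιB : 𝓞 K →+* End B}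
    {θB : (K : Type) →+* Module.End ℂ (complexBetti B.X 1)} (hB : IsCMTypeRealisation Ψ B ιB θB)
    {E₀ : Type} [Field E₀] [NumberField E₀] [IsCMField E₀] (k : E₀ →+* (K : Type)) {Φ₀ : CMType E₀}
    {E : AbelianVariety ℂ} {ιE : 𝓞 E₀ →+* End E} {θE : E₀ →+* Module.End ℂ (complexBetti E.X 1)}
    (hE : IsCMTypeRealisation Φ₀ E ιE θE)
    {k' : Type} [Field k'] [NumberField k'] [IsCMField k'] {Φ' : CMType k'} {E' : AbelianVariety ℂ} {ιE' : 𝓞 k' →+* End E'}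
    {θE' : k' →+* Module.End ℂ (complexBetti E'.X 1)} (hE' : IsCMTypeRealisation Φ' E' ιE' θE')
    (hk' : Module.finrank ℚ k' = 2) (hemb : IsEmpty (k' →+* (K : Type))) (a b c : ℕ)
    {A : AbelianVariety ℂ} (hA : AVDominatedBy A (((B.powSucc a).prod (E.powSucc b)).prod (E'.powSucc c))) :
    HodgeConjectureFor A.dim A.X :=
  hodgeConjectureFor_of_avDominatedBy_powSucc_prod_powSucc_prod_powSucc_sextic_of_markman hW4 K h6 hB k hE hE'
    (isNondegenerate_of_finrank_eq_two Φ' hk') (normalClosure_inf_normalClosure_eq_bot_of_isEmpty hk' hemb) a b c hA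

end CyclicSextic

end Summit.HodgeConjecture.CorCM

end
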